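import Literature.Barriers.NavierStokesRegularity.NavierStokesInequalitySwirlCalculus
import HarnessLib

/-!
# Calculus of the fields `u[v,f]`, IV: joint smoothness of time-dependent swirl fields

Barrier catalogue support file for `NavierStokesRegularity` (D-0021), on the decomposition path
of `Literature.Barriers.NavierStokesRegularity.NSIBlock_of_arrangement` (fact D of
`NavierStokesInequalityArrangement`; Ożański, arXiv:1709.00602v4, §4). Proposition 4.2 there
asserts `u ∈ C^∞(ℝ³ × (-η, T+η); ℝ³)` for `u(x,t) = u[a₁ᵏ(t)v₁, q₁ᵏ_t](x) + u[a₂ᵏ(t)v₂, q₂ᵏ_t](x)`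
((4.26)): "Claim (i) and the smoothness of `u` on `ℝ³ × (-η, T+η)` follow directly from (4.31)
[the structures `(aᵢᵏ(t)vᵢ, qᵏᵢ,ₜ, φᵢ)`], the smoothness of the oscillatory processes on `ℝ`
and the smoothness of `q₁ᵏ, q₂ᵏ`" (§4.2). This file proves the corresponding statement for the
tree's rendering — the tree's `IsNSIBlock.smooth` asks for `Fluid.IsSmoothSpaceTimeOn`, joint
smoothness of `(t,x) ↦ u(t,x)` on `S × ℝ³`:

* `contDiffOn_comp_meridian_param` — a jointly smooth planar profile `G(t,q)` vanishing for
  `r < r₀` lifts to a jointly smooth `(t,x) ↦ G(t, meridian x)` on `S × ℝ³`;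
* `contDiffOn_swirl_sqrt_param` — the swirl profile `√(Q(t,q)² - a(t)²|v(q)|²)` is jointly smooth
  when `Q > |v| ≥ |a v|` on `U` and `v = 0` off `U`;
* `isSmoothSpaceTimeOn_swirlField_param` — **`(t,x) ↦ u[a(t)v, Q(t)](x)` is jointly `C^∞` on
  `S × ℝ³`** for a direction `a ∈ C^∞(ℝ; [-1,1])`, a planar field `v ∈ C_c^∞(U)`, and profiles
  `Q` jointly `C^∞` on `S × ℝ²`, nonnegative, vanishing off `Ū`, with `Q(t) > |v|` on `U`
  (`Ū ⊆ P` compact) — the hypotheses recorded in `IsNSIProfileData`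
  (`NavierStokesInequalityProfiles`) and available for Ożański's `(aᵢᵏ, qᵏᵢ)` by (4.30)–(4.31);
  the sum of two such fields is then handled by the tree's `IsSmoothSpaceTimeOn.add`
  (`FluidPDE/ClassicalSolutionCalculus`).

## References

* W. S. Ożański, arXiv:1709.00602v4, §4.1 (4.26), (4.30)–(4.31), §4.2 (claim (i)), Prop. 4.2.
  [`Ozanski2017NSISingular`] (Held plain-text rendering: "Proposition 9".)
-/

noncomputable section

open MeasureTheory Set Function Filter Topology TopologicalSpace WithLp Metric
open scoped ENNReal InnerProductSpace RealInnerProductSpace ContDiff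

namespace Literature.Barriers.NavierStokesRegularity

open Literature.Analysis.FluidPDE

/-! ### Lifting jointly smooth planar profiles -/

/-- **Lifting with a parameter**: if `G : ℝ × (ℝ × ℝ) → F` is `Cⁿ` on `S × ℝ²` and
`G(t,q) = 0` for `t ∈ S`, `q.1 < r₀` (`r₀ > 0`), then `(t,x) ↦ G(t, meridian x)` is `Cⁿ` on
`S × ℝ³`. [folklore] -/
theorem contDiffOn_comp_meridian_param {F : Type*} [NormedAddCommGroup F] [NormedSpace ℝ F]
    {G : ℝ × (ℝ × ℝ) → F} {S : Set ℝ} {n : WithTop ℕ∞} (hG : ContDiffOn ℝ n G (S ×ˢ univ))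
    {r₀ : ℝ} (hr₀ : 0 < r₀) (h0 : ∀ t ∈ S, ∀ q : ℝ × ℝ, q.1 < r₀ → G (t, q) = 0) :
    ContDiffOn ℝ n (fun p : ℝ × EuclideanSpace ℝ (Fin 3) => G (p.1, meridian p.2))
      (S ×ˢ univ) := by
  rintro ⟨t, x⟩ ⟨ht, -⟩
  by_cases hx : cylRadius x < r₀
  · have ho : IsOpen {p : ℝ × EuclideanSpace ℝ (Fin 3) | cylRadius p.2 < r₀} :=
      isOpen_lt (continuous_cylRadius.comp continuous_snd) continuous_const
    have heq : (fun p : ℝ × EuclideanSpace ℝ (Fin 3) => G (p.1, meridian p.2))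
        =ᶠ[𝓝[S ×ˢ univ] (t, x)] fun _ => 0 := by
      filter_upwards [inter_mem (mem_nhdsWithin_of_mem_nhds (ho.mem_nhds hx)) self_mem_nhdsWithin]
        with p hp using h0 _ hp.2.1 _ hp.1
    exact (contDiffWithinAt_const (c := (0 : F))).congr_of_eventuallyEq heq (h0 _ ht _ hx)
  · have hx' : cylRadius x ≠ 0 := fun h => hx (h ▸ hr₀)
    have hmer : ContDiffWithinAt ℝ n (fun p : ℝ × EuclideanSpace ℝ (Fin 3) => meridian p.2)
        (S ×ˢ univ) (t, x) :=
      (contDiffAt_meridian hx').comp_contDiffWithinAt (t, x) contDiffWithinAt_snd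
    have hm : ContDiffWithinAt ℝ n (fun p : ℝ × EuclideanSpace ℝ (Fin 3) => (p.1, meridian p.2))
        (S ×ˢ univ) (t, x) := contDiffWithinAt_fst.prodMk hmer
    exact (hG (t, meridian x) ⟨ht, mem_univ _⟩).comp (t, x) hm
      fun p hp => mk_mem_prod hp.1 (mem_univ _)

/-- Division by `r` with a parameter: if `g : ℝ × (ℝ × ℝ) → ℝ` is `Cⁿ` on `S × ℝ²` and vanishes
for `t ∈ S`, `q.1 < r₀` (`r₀ > 0`), then so is `g(t,q)/r`. [folklore] -/
theorem contDiffOn_mul_inv_fst_param {g : ℝ × (ℝ × ℝ) → ℝ} {S : Set ℝ} {n : WithTop ℕ∞}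
    (hg : ContDiffOn ℝ n g (S ×ˢ univ)) {r₀ : ℝ} (hr₀ : 0 < r₀)
    (h0 : ∀ t ∈ S, ∀ q : ℝ × ℝ, q.1 < r₀ → g (t, q) = 0) :
    ContDiffOn ℝ n (fun p : ℝ × (ℝ × ℝ) => g p * p.2.1⁻¹) (S ×ˢ univ) := by
  rintro ⟨t, q⟩ ⟨ht, -⟩
  by_cases hq : q.1 < r₀
  · have ho : IsOpen {p : ℝ × (ℝ × ℝ) | p.2.1 < r₀} :=
      isOpen_lt (continuous_fst.comp continuous_snd) continuous_const
    have heq : (fun p : ℝ × (ℝ × ℝ) => g p * p.2.1⁻¹) =ᶠ[𝓝[S ×ˢ univ] (t, q)] fun _ => 0 := by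
      filter_upwards [inter_mem (mem_nhdsWithin_of_mem_nhds (ho.mem_nhds hq)) self_mem_nhdsWithin]
        with p hp
      rw [show p = (p.1, p.2) from rfl, h0 _ hp.2.1 _ hp.1, zero_mul]
    exact (contDiffWithinAt_const (c := (0 : ℝ))).congr_of_eventuallyEq heq
      (by simp [h0 _ ht _ hq])
  · have hq' : q.1 ≠ 0 := fun h => hq (h ▸ hr₀)
    have h2 : ContDiff ℝ n fun p : ℝ × (ℝ × ℝ) => p.2.1 := contDiff_snd.fst
    exact (hg (t, q) ⟨ht, mem_univ _⟩).mul ((h2.contDiffAt.contDiffWithinAt).inv hq')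

/-! ### The time-dependent swirl profile -/

section Param

variable {S : Set ℝ} {U : Set (ℝ × ℝ)} {v : ℝ × ℝ → ℝ × ℝ} {a : ℝ → ℝ} {Q : ℝ → ℝ × ℝ → ℝ}

/-- **The swirl profile with a parameter is jointly smooth**: for `v` smooth with
`supp v ⊆ U`, `a ∈ C^∞(ℝ;[-1,1])`, and `Q` jointly `C^∞` on `S × ℝ²` with `Q ≥ 0` and
`Q(t) > |v|` on `U` for `t ∈ S`, the function `(t,q) ↦ √(Q(t,q)² - a(t)²|v(q)|²)` is jointly `C^∞`
on `S × ℝ²` (positive radicand on `U`; equal to `Q` off `supp v`). [folklore] -/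
theorem contDiffOn_swirl_sqrt_param (hv : ContDiff ℝ ∞ v) (hvU : tsupport v ⊆ U)
    (ha : ContDiff ℝ ∞ a) (ha1 : ∀ t, |a t| ≤ 1)
    (hQ : ContDiffOn ℝ ∞ (uncurry Q) (S ×ˢ univ)) (hQ0 : ∀ t ∈ S, ∀ q, 0 ≤ Q t q)
    (hQv : ∀ t ∈ S, ∀ q ∈ U, (v q).1 ^ 2 + (v q).2 ^ 2 < Q t q ^ 2) :
    ContDiffOn ℝ ∞ (fun p : ℝ × (ℝ × ℝ) =>
      Real.sqrt (Q p.1 p.2 ^ 2 - (((a p.1 • v) p.2).1 ^ 2 + ((a p.1 • v) p.2).2 ^ 2)))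
      (S ×ˢ univ) := by
  have hR : ContDiffOn ℝ ∞ (fun p : ℝ × (ℝ × ℝ) =>
      Q p.1 p.2 ^ 2 - (((a p.1 • v) p.2).1 ^ 2 + ((a p.1 • v) p.2).2 ^ 2)) (S ×ˢ univ) := by
    have hav : ContDiff ℝ ∞ fun p : ℝ × (ℝ × ℝ) => (a p.1 • v) p.2 :=
      ((ha.comp contDiff_fst).smul (hv.comp contDiff_snd))
    exact (hQ.pow 2).sub
      (((contDiff_fst.comp hav).pow 2).add ((contDiff_snd.comp hav).pow 2)).contDiffOn
  rintro ⟨t, q⟩ ⟨ht, -⟩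
  by_cases hq : q ∈ U
  · refine (hR (t, q) ⟨ht, mem_univ _⟩).sqrt (ne_of_gt ?_)
    have ha2 : a t ^ 2 ≤ 1 := by
      have := abs_le.1 (ha1 t); nlinarith
    have hvv : 0 ≤ (v q).1 ^ 2 + (v q).2 ^ 2 := by positivity
    have key := hQv t ht q hq
    calc (0 : ℝ) < Q t q ^ 2 - 1 * ((v q).1 ^ 2 + (v q).2 ^ 2) := by linarith
      _ ≤ Q t q ^ 2 - a t ^ 2 * ((v q).1 ^ 2 + (v q).2 ^ 2) := by nlinarith
      _ = _ := by simp; ring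
  · -- off `U` (so off `supp v`): the profile is `Q`, for `t ∈ S`
    have hq' : q ∉ tsupport v := fun h => hq (hvU h)
    have hO : IsOpen ((tsupport v)ᶜ) := (isClosed_tsupport v).isOpen_compl
    have hmem : {p : ℝ × (ℝ × ℝ) | p.2 ∈ (tsupport v)ᶜ} ∩ (S ×ˢ univ) ∈ 𝓝[S ×ˢ univ] (t, q) :=
      inter_mem (mem_nhdsWithin_of_mem_nhds ((hO.preimage continuous_snd).mem_nhds hq'))
        self_mem_nhdsWithin
    have heq : (fun p : ℝ × (ℝ × ℝ) =>
        Real.sqrt (Q p.1 p.2 ^ 2 - (((a p.1 • v) p.2).1 ^ 2 + ((a p.1 • v) p.2).2 ^ 2)))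
        =ᶠ[𝓝[S ×ˢ univ] (t, q)] fun p => uncurry Q p := by
      filter_upwards [hmem] with p hp
      have hv0 : v p.2 = 0 := image_eq_zero_of_notMem_tsupport hp.1
      simp only [Pi.smul_apply, hv0, smul_zero, Prod.fst_zero, Prod.snd_zero, uncurry]
      rw [show ((0 : ℝ) ^ 2 + (0 : ℝ) ^ 2) = 0 by norm_num, sub_zero,
        Real.sqrt_sq (hQ0 p.1 hp.2.1 p.2)]
    refine (hQ (t, q) ⟨ht, mem_univ _⟩).congr_of_eventuallyEq heq ?_
    have hv0 : v q = 0 := image_eq_zero_of_notMem_tsupport hq'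
    simp only [Pi.smul_apply, hv0, smul_zero, Prod.fst_zero, Prod.snd_zero, uncurry]
    rw [show ((0 : ℝ) ^ 2 + (0 : ℝ) ^ 2) = 0 by norm_num, sub_zero, Real.sqrt_sq (hQ0 t ht q)]

/-- **Joint smoothness of a time-dependent swirl field** (Ożański, §4.2, claim (i) of Prop. 4.2:
"the smoothness of `u` on `ℝ³ × (-η, T+η)` follows directly from (4.31), the smoothness of the
oscillatory processes and the smoothness of `q₁ᵏ, q₂ᵏ`"): for a direction `a ∈ C^∞(ℝ;[-1,1])`,
a planar field `v ∈ C^∞` supported in the open set `U` whose closure is a compact subset of the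
open half-plane `P`, and profiles `Q` jointly `C^∞` on `S × ℝ²`, nonnegative on `S`, vanishing
off `Ū`, with `Q(t) > |v|` on `U`, the field `(t,x) ↦ u[a(t)v, Q(t)](x)` is jointly `C^∞` on
`S × ℝ³` (`Fluid.IsSmoothSpaceTimeOn`). [cite: Ozanski2017NSISingular, Prop. 4.2 (i) and §4.2] -/
theorem isSmoothSpaceTimeOn_swirlField_param (hUc : IsCompact (closure U))
    (hUP : closure U ⊆ halfPlane) (hv : ContDiff ℝ ∞ v) (hvU : tsupport v ⊆ U)
    (ha : ContDiff ℝ ∞ a) (ha1 : ∀ t, |a t| ≤ 1)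
    (hQ : ContDiffOn ℝ ∞ (uncurry Q) (S ×ˢ univ)) (hQ0 : ∀ t ∈ S, ∀ q, 0 ≤ Q t q)
    (hQz : ∀ t ∈ S, ∀ q ∉ closure U, Q t q = 0)
    (hQv : ∀ t ∈ S, ∀ q ∈ U, (v q).1 ^ 2 + (v q).2 ^ 2 < Q t q ^ 2) :
    IsSmoothSpaceTimeOn S fun t x => swirlField (a t • v) (Q t) x := by
  -- an axis margin: `r ≥ r₀ > 0` on `Ū`, so all planar data vanish for `r < r₀`
  obtain ⟨r₀, hr₀, hr⟩ : ∃ r₀ > 0, ∀ q ∈ closure U, r₀ ≤ q.1 := by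
    rcases (closure U).eq_empty_or_nonempty with hE | hE
    · exact ⟨1, one_pos, fun q hq => by simp [hE] at hq⟩
    · obtain ⟨q₀, hq₀, hmin⟩ := hUc.exists_isMinOn hE continuous_fst.continuousOn
      exact ⟨q₀.1, hUP hq₀, fun q hq => hmin hq⟩
  have hv0 : ∀ q : ℝ × ℝ, q.1 < r₀ → v q = 0 := fun q hq =>
    image_eq_zero_of_notMem_tsupport fun h => (hr q (subset_closure (hvU h))).not_gt hq
  have hQ0' : ∀ t (q : ℝ × ℝ), t ∈ S → q.1 < r₀ → Q t q = 0 := fun t q ht hq =>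
    hQz t ht q fun h => (hr q h).not_gt hq
  -- the three jointly smooth planar profiles
  have hav : ContDiff ℝ ∞ fun p : ℝ × (ℝ × ℝ) => (a p.1 • v) p.2 :=
    (ha.comp contDiff_fst).smul (hv.comp contDiff_snd)
  have hα : ContDiffOn ℝ ∞ (fun p : ℝ × EuclideanSpace ℝ (Fin 3) =>
      ((a p.1 • v) (meridian p.2)).1 * (meridian p.2).1⁻¹) (S ×ˢ univ) := by
    have h1 : ContDiffOn ℝ ∞ (fun p : ℝ × (ℝ × ℝ) => ((a p.1 • v) p.2).1 * p.2.1⁻¹) (S ×ˢ univ) :=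
      contDiffOn_mul_inv_fst_param (g := fun p => ((a p.1 • v) p.2).1)
        (contDiff_fst.comp hav).contDiffOn hr₀ fun t _ q hq => by simp [hv0 q hq]
    exact contDiffOn_comp_meridian_param (G := fun p => ((a p.1 • v) p.2).1 * p.2.1⁻¹) h1 hr₀
      fun t _ q hq => by simp [hv0 q hq]
  have hβ : ContDiffOn ℝ ∞ (fun p : ℝ × EuclideanSpace ℝ (Fin 3) =>
      ((a p.1 • v) (meridian p.2)).2) (S ×ˢ univ) :=
    contDiffOn_comp_meridian_param (G := fun p => ((a p.1 • v) p.2).2)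
      (contDiff_snd.comp hav).contDiffOn hr₀ fun t _ q hq => by simp [hv0 q hq]
  have hγ : ContDiffOn ℝ ∞ (fun p : ℝ × EuclideanSpace ℝ (Fin 3) =>
      Real.sqrt (Q p.1 (meridian p.2) ^ 2 -
        (((a p.1 • v) (meridian p.2)).1 ^ 2 + ((a p.1 • v) (meridian p.2)).2 ^ 2)) *
        (meridian p.2).1⁻¹) (S ×ˢ univ) := by
    have h1 := contDiffOn_swirl_sqrt_param (S := S) hv hvU ha ha1 hQ hQ0 hQv
    have h2 : ContDiffOn ℝ ∞ (fun p : ℝ × (ℝ × ℝ) =>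
        Real.sqrt (Q p.1 p.2 ^ 2 - (((a p.1 • v) p.2).1 ^ 2 + ((a p.1 • v) p.2).2 ^ 2)) * p.2.1⁻¹)
        (S ×ˢ univ) := by
      refine contDiffOn_mul_inv_fst_param
        (g := fun p =>
          Real.sqrt (Q p.1 p.2 ^ 2 - (((a p.1 • v) p.2).1 ^ 2 + ((a p.1 • v) p.2).2 ^ 2)))
        h1 hr₀ fun t ht q hq => ?_
      simp [hv0 q hq, hQ0' t q ht hq]
    exact contDiffOn_comp_meridian_param
      (G := fun p =>
        Real.sqrt (Q p.1 p.2 ^ 2 - (((a p.1 • v) p.2).1 ^ 2 + ((a p.1 • v) p.2).2 ^ 2)) *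
          p.2.1⁻¹) h2 hr₀ fun t ht q hq => by simp [hv0 q hq, hQ0' t q ht hq]
  -- assemble with the linear fields
  have hH : ContDiff ℝ ∞ fun p : ℝ × EuclideanSpace ℝ (Fin 3) =>
      (toLp 2 ![p.2 0, p.2 1, 0] : EuclideanSpace ℝ (Fin 3)) :=
    contDiff_horizontal.comp contDiff_snd
  have hJ : ContDiff ℝ ∞ fun p : ℝ × EuclideanSpace ℝ (Fin 3) => rotGen p.2 :=
    (rotGenL.contDiff : ContDiff ℝ ∞ (rotGen : _ → EuclideanSpace ℝ (Fin 3))).comp contDiff_snd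
  have key : ContDiffOn ℝ ∞ (fun p : ℝ × EuclideanSpace ℝ (Fin 3) =>
      (((a p.1 • v) (meridian p.2)).1 * (meridian p.2).1⁻¹) •
          (toLp 2 ![p.2 0, p.2 1, 0] : EuclideanSpace ℝ (Fin 3)) +
        ((a p.1 • v) (meridian p.2)).2 • eZ +
        (Real.sqrt (Q p.1 (meridian p.2) ^ 2 -
          (((a p.1 • v) (meridian p.2)).1 ^ 2 + ((a p.1 • v) (meridian p.2)).2 ^ 2)) *
          (meridian p.2).1⁻¹) • rotGen p.2) (S ×ˢ univ) :=
    ((hα.smul hH.contDiffOn).add (hβ.smul contDiffOn_const)).add (hγ.smul hJ.contDiffOn)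
  refine key.congr fun p _ => ?_
  simp only [uncurry]
  rw [swirlField_eq_linear]

end Param

end Literature.Barriers.NavierStokesRegularity
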